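import Literature.Analysis.ValidatedNumerics.TaylorModelMovingIntegral
import Literature.Analysis.ValidatedNumerics.TaylorModelExp
import Literature.Analysis.ValidatedNumerics.TaylorModelExpr
import HarnessLib

/-!
# Kernel-checkable certificates for one-dimensional integrals of elementary expressions

Trunk T-ANA (Analysis/ValidatedNumerics); namespace `Literature.Analysis.ValidatedNumerics.PolyMP`.
Sequel of `TaylorModelQuadrature.lean`, `TaylorModelMovingIntegral.lean`, `TaylorModelExp.lean`.  The validated
integration scheme of Makino–Berz (piecewise Taylor models, the remainder carried in interval coefficients, the
polynomial part integrated exactly) packaged as ONE Boolean certificate that the kernel can evaluate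
(`decide +kernel`) and ONE soundness theorem with no side hypotheses — the shape used by certificate-checking
integration inside proof assistants (Mahboubi–Melquiond–Sibut-Pinote for Coq): an untrusted generator proposes
the data, the kernel re-computes the enclosure.

* `WExpr` — the integrand as a term in the variable `t`: exact rational polynomials, `e^{a+bt}` (`a, b ∈ ℚ`), `−`, `+`,
  `×`, reciprocal and square root; `WExpr.toFun` its real meaning (Mathlib's `Real.exp`, `⁻¹`, `Real.sqrt`, so a
  reciprocal of zero is the junk value `0` — irrelevant where a certificate is accepted, since `checkInv` proves the
  denominator bounded away from zero on every panel); `WExpr.measurable_toFun`.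
* `WExpr.model S h D K Ke ke c E cs` — the Taylor model of `u ↦ E(c + u)` on `|u| ≤ h`, built from the library's sound
  operations (`ratPolyI ∘ recenterAt`, `texpI`·`MI.expPt`, `tnegI`, `taddI`, `tmulI`, and the VERIFIED reciprocal /
  square root `checkInv` / `checkSqrt` whose thin candidates `(Q, e)` are consumed from the list `cs` in traversal
  order), together with its acceptance flag; `WExpr.tmem_model` — acceptance implies enclosure.
* `intervalIntegrable_of_tmem` — a measurable Taylor-modelled function is integrable on its panel (so NO global
  integrability hypothesis is needed: poles of `E` outside the panels are harmless);
  `mem_fullPanelsI_of_tmem` — the panel assembly of `TaylorModelMovingIntegral.fullPanelsI` under per-panel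
  enclosures only.
* `certData`, `certCheck S h D K Ke ke E q css lo hi` and **`integral_bounds_of_certCheck`**:
  `certCheck … = true → lo ≤ ∫₀^{2nh} E(t)·q(t) dt ≤ hi`, `n = css.length` panels of half-width `h`, `q` an exact
  rational polynomial weight, `css` the per-panel candidate lists.  Positivity of `S`, `h`, `K` and `|b h| ≤ 1` are
  part of the certificate, so the theorem has no hypotheses besides the kernel's `= true`.

A general interval `[a, b]` is reduced to `[0, b − a]` by the generator (shift the expression); `b − a = 2nh` fixes `h`.
Deliberately NOT here: logarithms and non-affine exponents inside `WExpr` (no interior Taylor model of `log` / of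
`exp ∘ f` in the library yet), endpoint singularities (see `TaylorModelLogEdge.lean` for logarithmic edge moments),
adaptive bisection (the generator chooses `n`, `h`, the orders and the scale `S`).  Problem-independent; no facts,
no axioms.

## References

* M. Joldeş, *Rigorous Polynomial Approximations and Applications*, PhD thesis, ENS Lyon (2011): Definition 2.1.3
  (Taylor model with absolute remainder), Algorithms 2.2.4–2.2.6, 2.2.9, 2.2.10 (reciprocal, sum, product, division,
  Taylor models of expressions), §4.5 (integration of rigorous polynomial approximations).
  [cite: Joldes2011, Definition 2.1.3]
* A. Mahboubi, G. Melquiond, T. Sibut-Pinote, *Formally verified approximations of definite integrals*, ITP 2016,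
  LNCS 9807, 274–289: Sect. 3.2 Lemma 3 (polynomial integral enclosure), Sect. 3.3 (interval decomposition),
  Sect. 4 (enclosures of expressions checked by computation). [cite: MahboubiMelquiondSibutpinote2016, Sect. 3.2 Lemma 3]
* K. Makino, M. Berz, *Taylor models and other validated functional inclusion methods*, Int. J. Pure Appl. Math. 4
  (2003) 379–456 (Taylor model arithmetic and validated integration; background). [cite: MakinoBerz2003, passim]
-/

open MeasureTheory intervalIntegral Set

namespace Literature.Analysis.ValidatedNumerics

namespace PolyMP

open Literature.Analysis.ValidatedNumerics.NumericsMP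
open Literature.Analysis.ValidatedNumerics.ExpPoly (Poly BPoly)
open Literature.Analysis.ValidatedNumerics.ExpPoly

/-! ### Small tools: re-centring, rational exponentials, midpoint polynomials, integrability on a panel -/

/-- `g(c + u)` as an exact polynomial in `u` (`BPoly.taylor` then substitute the constant `c`). [folklore] -/
def recenterAt (g : Poly) (c : ℚ) : Poly := BPoly.subst (BPoly.taylor g) [c]

/-- [folklore] -/
private theorem eval_recenterAt (g : Poly) (c : ℚ) (u : ℝ) :
    Poly.eval (recenterAt g c) u = Poly.eval g ((c : ℝ) + u) := by
  rw [recenterAt, BPoly.eval_subst, BPoly.eval_taylor]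
  simp [Poly.eval, add_comm]

/-- `e^x` for rational `x` as an `MI` by `MI.expPt` (junk `[0, 0]` when the enclosure is refused — the certificates
below test `isSome`). [folklore] -/
def expQ (S Ke ke : ℕ) (x : ℚ) : MI := (MI.expPt S Ke ke (ofRat S x)).getD ⟨0, 0⟩

/-- [folklore] -/
private theorem mem_expQ {S : ℕ} (hS : 0 < S) {Ke ke : ℕ} {x : ℚ}
    (h : (MI.expPt S Ke ke (ofRat S x)).isSome = true) : MI.mem S (Real.exp x) (expQ S Ke ke x) := by
  obtain ⟨Y, hY⟩ := Option.isSome_iff_exists.1 h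
  have : expQ S Ke ke x = Y := by simp [expQ, hY]
  rw [this]
  exact MI.mem_expPt hS hY (mem_ofRat S x)

/-- The midpoint polynomial of a Taylor model (the reference polynomial integrated exactly). [folklore] -/
def midPoly (S : ℕ) (W : IPoly) : Poly := W.map fun I => ((I.lo + I.hi : ℤ) : ℚ) / (2 * (S : ℚ))

/-- **A measurable Taylor-modelled function is interval integrable on its panel** (it is bounded by `tabsI/S`;
op. cit. assumes integrability of the integrand, here it follows from the model).
[cite: MahboubiMelquiondSibutpinote2016, Sect. 3.2 Lemma 3] -/
theorem intervalIntegrable_of_tmem {S : ℕ} (hS : 0 < S) {h : ℚ} (h0 : 0 ≤ h) {f : ℝ → ℝ} {P : IPoly}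
    (hf : TMem S h f P) (hm : Measurable f) : IntervalIntegrable f volume (-(h : ℝ)) h := by
  have hh : (0 : ℝ) ≤ h := by exact_mod_cast h0
  have hle : (-(h : ℝ)) ≤ h := by linarith
  rw [intervalIntegrable_iff_integrableOn_Icc_of_le hle]
  refine Measure.integrableOn_of_bounded (M := ((tabsI S h P : ℤ) : ℝ) / S)
    (by rw [Real.volume_Icc]; exact ENNReal.ofReal_ne_top) hm.aestronglyMeasurable ?_
  refine (ae_restrict_iff' measurableSet_Icc).2 (Filter.Eventually.of_forall fun x hx => ?_)
  have hxa : |x| ≤ h := abs_le.2 ⟨hx.1, hx.2⟩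
  have hb := abs_le_tabsI h0 hf hxa
  rw [Real.norm_eq_abs, le_div_iff₀ (by exact_mod_cast hS)]
  exact hb

/-- **Panel assembly under per-panel enclosures only.**  If `w` is measurable and `W_i` encloses
`u ↦ w(t_{j₀+i} + u)` for every entry of the data (`t_j = (2j+1)h`), then `fullPanelsI` encloses
`∫_{2j₀h}^{2(j₀+n)h} w(t) q(t) dt`, and that integrand is interval integrable there (polynomial integral enclosure
per panel, summed over the decomposition of the interval). [cite: MahboubiMelquiondSibutpinote2016, Sect. 3.2 Lemma 3, Sect. 3.3] -/
theorem mem_fullPanelsI_of_tmem {S : ℕ} (hS : 0 < S) {h : ℚ} (h0 : 0 ≤ h) {w : ℝ → ℝ} (hw : Measurable w)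
    (q : Poly) : ∀ (D : List (IPoly × Poly)) (j₀ : ℕ),
      (∀ i : Fin D.length, TMem S h (fun u => w ((panelCentre h (j₀ + i) : ℝ) + u)) (D.get i).1) →
      MI.mem S (∫ t in (2 * j₀ * h : ℝ)..(2 * (j₀ + D.length) * h : ℝ), w t * Poly.eval q t)
          (fullPanelsI S h q D j₀) ∧
        IntervalIntegrable (fun t => w t * Poly.eval q t) volume (2 * j₀ * h : ℝ) (2 * (j₀ + D.length) * h : ℝ)
  | [], j₀, _ => by
      simp only [List.length_nil, Nat.cast_zero, add_zero, intervalIntegral.integral_same, fullPanelsI]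
      exact ⟨by simpa using MI.mem_ofScaled hS 0, IntervalIntegrable.refl⟩
  | (W, pw) :: D, j₀, hD => by
      have hhr : (0 : ℝ) ≤ h := by exact_mod_cast h0
      rw [fullPanelsI]
      -- the first panel, shifted to `[-h, h]`
      have hW : TMem S h (fun u => w ((panelCentre h j₀ : ℝ) + u)) W := by simpa using hD ⟨0, by simp⟩
      have hfi : IntervalIntegrable (fun u => w ((panelCentre h j₀ : ℝ) + u)) volume (-(h : ℝ)) h :=
        intervalIntegrable_of_tmem hS h0 hW (hw.comp (measurable_const.add measurable_id))
      have hI1 : IntervalIntegrable (fun t => w t * Poly.eval q t) volume (2 * j₀ * h : ℝ) (2 * (j₀ + 1) * h : ℝ) := by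
        have h1 := hfi.comp_sub_right ((panelCentre h j₀ : ℝ))
        have e0 : (fun x => w ((panelCentre h j₀ : ℝ) + (x - (panelCentre h j₀ : ℝ)))) = w := by
          funext x; congr 1; ring
        rw [e0] at h1
        have e1 : -(h : ℝ) + (panelCentre h j₀ : ℝ) = 2 * j₀ * h := by simp only [panelCentre]; push_cast; ring
        have e2 : (h : ℝ) + (panelCentre h j₀ : ℝ) = 2 * (j₀ + 1) * h := by simp only [panelCentre]; push_cast; ring
        rw [e1, e2] at h1
        exact h1.mul_continuousOn (Poly.continuous_eval q).continuousOn
      -- the remaining panels, by induction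
      have hD' : ∀ i : Fin D.length, TMem S h (fun u => w ((panelCentre h (j₀ + 1 + i) : ℝ) + u)) (D.get i).1 := by
        intro i
        have := hD ⟨i + 1, by simp⟩
        simpa [Nat.add_assoc, Nat.add_comm 1 i] using this
      obtain ⟨ih, hI2⟩ := mem_fullPanelsI_of_tmem hS h0 hw q D (j₀ + 1) hD'
      simp only [List.length_cons, Nat.cast_succ] at ih hI2 ⊢
      have hI2' : IntervalIntegrable (fun t => w t * Poly.eval q t) volume (2 * (j₀ + 1) * h : ℝ)
          (2 * (j₀ + (D.length + 1)) * h : ℝ) := by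
        convert hI2 using 2; ring
      refine ⟨?_, (hI1.trans hI2')⟩
      rw [← integral_add_adjacent_intervals hI1 hI2']
      refine MI.mem_add ?_ ?_
      · have hm := mem_panelIntegI hS h0 hW hfi pw (recenter q h j₀)
        have e : ∫ u in (-(h : ℝ))..h, w ((panelCentre h j₀ : ℝ) + u) * Poly.eval (recenter q h j₀) u =
            ∫ t in (2 * j₀ * h : ℝ)..(2 * (j₀ + 1) * h : ℝ), w t * Poly.eval q t := by
          simp_rw [eval_recenter]
          have hs := intervalIntegral.integral_comp_add_left (fun t => w t * Poly.eval q t) ((panelCentre h j₀ : ℝ))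
            (a := -(h : ℝ)) (b := h)
          rw [hs]
          simp only [panelCentre]
          push_cast
          congr 1 <;> ring
        rwa [e] at hm
      · convert ih using 3; ring

/-! ### The expression language -/

/-- Integrand expressions in one real variable `t`: exact rational polynomials, `e^{a + b t}`, negation, sum,
product, reciprocal, square root (the case analysis of the Taylor-model construction of an expression).
[cite: Joldes2011, Algorithm 2.2.10] -/
inductive WExpr : Type
  /-- an exact rational polynomial `g(t)` -/
  | poly (g : Poly) : WExpr
  /-- `e^{a + b t}`, `a b : ℚ` -/
  | expAff (a b : ℚ) : WExpr
  /-- `−A` -/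
  | neg (A : WExpr) : WExpr
  /-- `A + B` -/
  | add (A B : WExpr) : WExpr
  /-- `A · B` -/
  | mul (A B : WExpr) : WExpr
  /-- `1 / A` (a certificate node: consumes one thin candidate per panel) -/
  | inv (A : WExpr) : WExpr
  /-- `√A` (a certificate node: consumes one thin candidate per panel) -/
  | sqrt (A : WExpr) : WExpr

namespace WExpr

/-- The real function denoted by an expression. [folklore] -/
noncomputable def toFun : WExpr → ℝ → ℝ
  | poly g => fun t => Poly.eval g t
  | expAff a b => fun t => Real.exp ((a : ℝ) + b * t)
  | neg A => fun t => -toFun A t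
  | add A B => fun t => toFun A t + toFun B t
  | mul A B => fun t => toFun A t * toFun B t
  | inv A => fun t => (toFun A t)⁻¹
  | sqrt A => fun t => Real.sqrt (toFun A t)

/-- [folklore] -/
private theorem measurable_toFun : ∀ E : WExpr, Measurable E.toFun
  | poly g => (Poly.continuous_eval g).measurable
  | expAff a b => by
      show Measurable fun t : ℝ => Real.exp ((a : ℝ) + b * t)
      exact Real.measurable_exp.comp (measurable_const.add (measurable_const.mul measurable_id))
  | neg A => (measurable_toFun A).neg
  | add A B => (measurable_toFun A).add (measurable_toFun B)
  | mul A B => (measurable_toFun A).mul (measurable_toFun B)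
  | inv A => (measurable_toFun A).inv
  | sqrt A => Real.continuous_sqrt.measurable.comp (measurable_toFun A)

/-- The result of modelling a sub-expression: the Taylor model, the unconsumed candidates, the acceptance flag
(plumbing record of the expression walk). [cite: Joldes2011, Algorithm 2.2.10] -/
structure MRes where
  /-- the Taylor model -/
  P : IPoly
  /-- candidates not yet consumed -/
  rest : List (List ℤ × ℕ)
  /-- all checks so far passed -/
  ok : Bool

/-- **The panel Taylor model of `u ↦ E(c + u)` on `|u| ≤ h`** (scale `S`, truncation degree `D` for products and
the reciprocal / square-root checks, `K` Taylor terms for `e^{bu}`, `Ke` terms and `ke` squarings for the constants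
`e^{a + bc}`), consuming the reciprocal / square-root candidates `cs` in traversal order.
[cite: Joldes2011, Algorithm 2.2.10] -/
def model (S : ℕ) (h : ℚ) (D K Ke ke : ℕ) (c : ℚ) : WExpr → List (List ℤ × ℕ) → MRes
  | poly g, cs => ⟨ratPolyI S (recenterAt g c), cs, true⟩
  | expAff a b, cs => ⟨tsmulI S (expQ S Ke ke (a + b * c)) (texpI S h K b), cs,
      (MI.expPt S Ke ke (ofRat S (a + b * c))).isSome && decide (|b * h| ≤ 1) && decide (0 < K)⟩
  | neg A, cs =>
      let r := model S h D K Ke ke c A cs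
      ⟨tnegI r.P, r.rest, r.ok⟩
  | add A B, cs =>
      let r := model S h D K Ke ke c A cs
      let r' := model S h D K Ke ke c B r.rest
      ⟨taddI r.P r'.P, r'.rest, r.ok && r'.ok⟩
  | mul A B, cs =>
      let r := model S h D K Ke ke c A cs
      let r' := model S h D K Ke ke c B r.rest
      ⟨tmulI S h D r.P r'.P, r'.rest, r.ok && r'.ok⟩
  | inv A, cs =>
      let r := model S h D K Ke ke c A cs
      match r.rest with
      | [] => ⟨[], [], false⟩
      | d :: cs' => ⟨widen0 (thinI d.1) d.2, cs', r.ok && checkInv S h D r.P (thinI d.1) d.2⟩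
  | sqrt A, cs =>
      let r := model S h D K Ke ke c A cs
      match r.rest with
      | [] => ⟨[], [], false⟩
      | d :: cs' => ⟨widen0 (thinI d.1) d.2, cs', r.ok && checkSqrt S h D r.P (thinI d.1) d.2⟩

/-- **Soundness of `model`**: an accepted model encloses `u ↦ E(c + u)` on `|u| ≤ h` (a Taylor model with absolute
remainder in the sense of op. cit. Definition 2.1.3, the remainder carried in the interval coefficients).
[cite: Joldes2011, Algorithm 2.2.10] -/
theorem tmem_model {S : ℕ} (hS : 0 < S) {h : ℚ} (h0 : 0 ≤ h) {D K Ke ke : ℕ} (c : ℚ) :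
    ∀ (E : WExpr) (cs : List (List ℤ × ℕ)), (model S h D K Ke ke c E cs).ok = true →
      TMem S h (fun u => E.toFun ((c : ℝ) + u)) (model S h D K Ke ke c E cs).P
  | poly g, cs, _ => by
      have hm := tmem_ratPoly S h (recenterAt g c)
      simp only [eval_recenterAt] at hm
      exact hm
  | expAff a b, cs, hok => by
      simp only [model, Bool.and_eq_true, decide_eq_true_eq] at hok
      obtain ⟨⟨hsome, hbh⟩, hK⟩ := hok
      have hm := tmem_smulI hS (mem_expQ hS hsome) (tmem_exp (S := S) (h := h) hK hbh)
      intro ρ hρ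
      obtain ⟨as, has, hev⟩ := hm ρ hρ
      refine ⟨as, has, ?_⟩
      rw [← hev]
      show Real.exp ((a : ℝ) + b * ((c : ℝ) + ρ)) = _
      push_cast
      rw [← Real.exp_add]
      congr 1
      ring
  | neg A, cs, hok => by
      simp only [model] at hok ⊢
      exact tmem_neg (tmem_model hS h0 c A cs hok)
  | add A B, cs, hok => by
      simp only [model, Bool.and_eq_true] at hok ⊢
      exact tmem_add (tmem_model hS h0 c A cs hok.1) (tmem_model hS h0 c B _ hok.2)
  | mul A B, cs, hok => by
      simp only [model, Bool.and_eq_true] at hok ⊢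
      exact tmem_mul hS h0 D (tmem_model hS h0 c A cs hok.1) (tmem_model hS h0 c B _ hok.2)
  | inv A, cs, hok => by
      have ih := tmem_model hS h0 c A cs (D := D) (K := K) (Ke := Ke) (ke := ke)
      simp only [model] at hok ⊢
      rcases hr : (model S h D K Ke ke c A cs).rest with _ | ⟨d, cs'⟩
      · simp [hr] at hok
      · simp only [hr, Bool.and_eq_true] at hok ⊢
        exact tmem_inv_of_check hS h0 (ih hok.1) (tmem_thin hS h d.1) hok.2
  | sqrt A, cs, hok => by
      have ih := tmem_model hS h0 c A cs (D := D) (K := K) (Ke := Ke) (ke := ke)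
      simp only [model] at hok ⊢
      rcases hr : (model S h D K Ke ke c A cs).rest with _ | ⟨d, cs'⟩
      · simp [hr] at hok
      · simp only [hr, Bool.and_eq_true] at hok ⊢
        exact tmem_sqrt_of_check hS h0 (ih hok.1) (tmem_thin hS h d.1) hok.2

end WExpr

/-! ### The certificate -/

/-- The panel data `(W_j, pw_j)` of panels `j₀, j₀+1, …` with its conjunctive acceptance flag; one candidate list per
panel. [folklore] -/
def certData (S : ℕ) (h : ℚ) (D K Ke ke : ℕ) (E : WExpr) : List (List (List ℤ × ℕ)) → ℕ → List (IPoly × Poly) × Bool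
  | [], _ => ([], true)
  | cs :: css, j =>
      let r := WExpr.model S h D K Ke ke (panelCentre h j) E cs
      let t := certData S h D K Ke ke E css (j + 1)
      ((r.P, midPoly S r.P) :: t.1, r.ok && t.2)

/-- [folklore] -/
private theorem length_certData (S : ℕ) (h : ℚ) (D K Ke ke : ℕ) (E : WExpr) :
    ∀ (css : List (List (List ℤ × ℕ))) (j : ℕ), (certData S h D K Ke ke E css j).1.length = css.length
  | [], _ => rfl
  | _ :: css, j => by simp [certData, length_certData S h D K Ke ke E css (j + 1)]

/-- [folklore] -/
private theorem tmem_certData {S : ℕ} (hS : 0 < S) {h : ℚ} (h0 : 0 ≤ h) {D K Ke ke : ℕ} (E : WExpr) :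
    ∀ (css : List (List (List ℤ × ℕ))) (j₀ : ℕ), (certData S h D K Ke ke E css j₀).2 = true →
      ∀ i : Fin (certData S h D K Ke ke E css j₀).1.length,
        TMem S h (fun u => E.toFun ((panelCentre h (j₀ + (i : ℕ)) : ℝ) + u))
          ((certData S h D K Ke ke E css j₀).1.get i).1
  | [], _, _, i => i.elim0
  | cs :: css, j₀, hok, ⟨0, _⟩ => by
      simp only [certData, Bool.and_eq_true] at hok
      simpa [certData] using WExpr.tmem_model hS h0 (panelCentre h j₀) E cs hok.1
  | cs :: css, j₀, hok, ⟨i + 1, hi⟩ => by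
      simp only [certData, Bool.and_eq_true] at hok
      have hi' : i < (certData S h D K Ke ke E css (j₀ + 1)).1.length := by
        simpa [certData] using hi
      have ih := tmem_certData hS h0 E css (j₀ + 1) hok.2 ⟨i, hi'⟩
      have e : j₀ + 1 + i = j₀ + (i + 1) := by omega
      simpa [certData, e] using ih

/-- **The certificate** for `lo ≤ ∫₀^{2nh} E(t) q(t) dt ≤ hi` (`n = css.length`): positivity of `S` and `h`, every
panel model accepted, and the kernel enclosure inside `[lo·S, hi·S]`. [folklore] -/
def certCheck (S : ℕ) (h : ℚ) (D K Ke ke : ℕ) (E : WExpr) (q : Poly) (css : List (List (List ℤ × ℕ)))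
    (lo hi : ℚ) : Bool :=
  let d := certData S h D K Ke ke E css 0
  let I := fullPanelsI S h q d.1 0
  decide (0 < S) && decide (0 < h) && d.2 && decide (lo * S ≤ (I.lo : ℚ)) && decide ((I.hi : ℚ) ≤ hi * S)

/-- **Soundness of the certificate** (no side hypotheses): the polynomial integral enclosure of op. cit., the
enclosure re-computed by the kernel from untrusted data.
[cite: MahboubiMelquiondSibutpinote2016, Sect. 3.2 Lemma 3, Sect. 4 (3)] -/
theorem integral_bounds_of_certCheck {S : ℕ} {h : ℚ} {D K Ke ke : ℕ} {E : WExpr} {q : Poly}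
    {css : List (List (List ℤ × ℕ))} {lo hi : ℚ} (hc : certCheck S h D K Ke ke E q css lo hi = true) :
    (lo : ℝ) ≤ ∫ t in (0 : ℝ)..(2 * css.length * (h : ℝ)), E.toFun t * Poly.eval q t ∧
      ∫ t in (0 : ℝ)..(2 * css.length * (h : ℝ)), E.toFun t * Poly.eval q t ≤ (hi : ℝ) := by
  unfold certCheck at hc
  simp only [Bool.and_eq_true, decide_eq_true_eq] at hc
  obtain ⟨⟨⟨⟨hS, h0⟩, hok⟩, hlo⟩, hhi⟩ := hc
  have hD := tmem_certData hS h0.le E css 0 hok (D := D) (K := K) (Ke := Ke) (ke := ke)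
  simp only [Nat.zero_add] at hD
  obtain ⟨hm, -⟩ := mem_fullPanelsI_of_tmem hS h0.le (WExpr.measurable_toFun E) q
    (certData S h D K Ke ke E css 0).1 0 (fun i => by simpa using hD i)
  rw [length_certData] at hm
  have e1 : (2 * ((0 : ℕ) : ℝ) * (h : ℝ)) = 0 := by simp
  have e2 : (2 * (((0 : ℕ) : ℝ) + (css.length : ℕ)) * (h : ℝ)) = 2 * css.length * (h : ℝ) := by simp
  rw [e1, e2] at hm
  obtain ⟨h1, h2⟩ := hm
  have hSr : (0 : ℝ) < S := by exact_mod_cast hS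
  have hloR : (lo : ℝ) * S ≤ ((fullPanelsI S h q (certData S h D K Ke ke E css 0).1 0).lo : ℝ) := by
    exact_mod_cast hlo
  have hhiR : ((fullPanelsI S h q (certData S h D K Ke ke E css 0).1 0).hi : ℝ) ≤ (hi : ℝ) * S := by
    exact_mod_cast hhi
  exact ⟨le_of_mul_le_mul_right (hloR.trans h1) hSr, le_of_mul_le_mul_right (h2.trans hhiR) hSr⟩

end PolyMP

end Literature.Analysis.ValidatedNumerics
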